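import Literature.AlgebraicGeometry.Modules.SectionsTorsionFree
import Literature.AlgebraicGeometry.Motives.ChernClassesProofs
import Mathlib.Topology.Sheaves.SheafCondition.UniqueGluing
import HarnessLib

/-!
# Locally free `𝒪_X`-modules over torsion-free rings of sections have no torsion

For an `𝒪_X`-module `M` on a scheme `X` and `m : ℤ`, "`M` has no `m`-torsion" is taken in the
categorical form `Mono (m • 𝟙 M)` used by the `p`-adic staircase complexes of this tree
(`Literature.Algebra.Homology.StaircaseComplexes`: X. Hu, arXiv:2507.12458, Def. 8.2, needs the
Hodge sheaves `Ωʲ_{𝒳/W}` of a smooth `W(k)`-scheme `𝒳` to be `p`-torsion-free AS SHEAVES). The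
dictionary with sections, `Mono (m • 𝟙 M) ↔ ∀ U, ∀ s ∈ Γ(M, U), m • s = 0 → s = 0`, is
`Literature.AlgebraicGeometry.Modules.schemeModules_mono_zsmul_id_iff_torsionFree`
(`Modules/SectionsTorsionFree`), which also treats TRIVIAL bundles `M ≅ 𝒪_X^I`. This file adds
"mono is local on the base" and deduces the LOCALLY free case:

* `over_torsionFree_iff`, `schemeModules_mono_zsmul_id_over_iff` — for an open `U`, the
  restriction `M.over U` (Mathlib `SheafOfModules.over`, a sheaf of modules on the site of opens
  over `U`, whose sections over `V ⊆ U` are literally `Γ(M, V)`) has no `m`-torsion iff no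
  section of `M` over an open `V ≤ U` is killed by `m`; `schemeModules_mono_zsmul_id_over` —
  restriction preserves `m`-torsion-freeness;
* `schemeModules_mono_zsmul_id_of_locally_torsionFree`, `schemeModules_mono_zsmul_id_of_cover`,
  `schemeModules_mono_zsmul_id_of_iSup_eq_top`, `schemeModules_mono_zsmul_id_iff_locally` —
  **locality**: if every point has a neighbourhood `U` with `Mono (m • 𝟙 (M.over U))`
  (equivalently: below which the sections of `M` have no `m`-torsion), then `Mono (m • 𝟙 M)`
  (a section killed by `m` vanishes on the members of the cover, hence vanishes: Mathlib
  `TopCat.Sheaf.eq_of_locally_eq'`);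
* `mono_zsmul_id_of_isFiniteLocallyFree` — **a finite locally free module**
  (`Literature.AlgebraicGeometry.Motives.IsFiniteLocallyFree`: `M|_U ≅ 𝒪_U^I`, `I` finite, near
  every point) **has no `m`-torsion as soon as no ring of sections `Γ(X, U)` has**
  (locality + the free case `SheafOfModules.mono_zsmul_id_free` of `SectionsTorsionFree` on the
  over-site of each trivialising open);
* `mono_zsmul_id_of_isLocallyFreeData`, `mono_zsmul_id_of_hasRankLE` — the same from locally free
  local generators data with finite index sets (Mathlib `SheafOfModules.LocalGeneratorsData`,
  `IsLocallyFreeData`; the shape of `Motives.HasRank` / `hasRank_hodgeSheaf_choose`) and from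
  `Motives.HasRankLE`.

[folklore] Everything is proved; no named facts. Mathlib (pin v4.32) has `Mono` ↔ objectwise for
presheaves and `TopCat.Sheaf.eq_of_locally_eq'`, but no locality-on-the-base statement for
monomorphisms of sheaves of modules and nothing relating `Mono (m • 𝟙 _)` to local freeness.
The sibling `Modules/LocallyFreeSectionsTorsionFree` proves the sectionwise statement
(`eq_zero_of_zsmul_eq_zero_of_isFiniteLocallyFree`, through local frames and germs) and the
`Mono` statement for the underlying ABELIAN sheaf `(SheafOfModules.toSheaf _).obj E`; the two
`Mono` forms are equivalent by `SheafOfModules.mono_zsmul_id_iff_mono_zsmul_id_toSheaf`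
(`SectionsTorsionFree`). Here the route is "mono is local", which also gives the converse
direction and the `LocalGeneratorsData` / `HasRankLE` forms.

NOT here: the geometric inputs (`Γ(𝒳, U)` has no `p`-torsion for `𝒳` flat over `W(k)`:
`Modules/FlatSectionsRegular`; `Ωᵃ` locally free for `𝒳/W` smooth:
`Motives/HodgeSheavesProofs`) and the resulting `p`-torsion-freeness of `𝒪_𝒳`, `Ω¹_{𝒳/W}`,
`Ωᵃ_{𝒳/W}` — see `Literature/AlgebraicGeometry/Motives/HodgeSheavesTorsionFree`; infinite-rank
locally free modules (the free case of `SectionsTorsionFree` is stated for finite rank only).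
-/

namespace Literature.AlgebraicGeometry.Modules

open _root_.CategoryTheory _root_.CategoryTheory.Limits Opposite
open _root_.AlgebraicGeometry
open Literature.AlgebraicGeometry.Motives

universe u

variable {X : Scheme.{u}}

/-! ### Sections of the restriction `M.over U` -/

/-- The sections of `M.over U` over `Y : Over U` (an open `Y.left ⊆ U`) are the sections
`Γ(M, Y.left)`, so they have no `m`-torsion iff no section of `M` over an open `V ≤ U` is killed
by `m`. [folklore] -/
theorem over_torsionFree_iff (M : X.Modules) (U : X.Opens) (m : ℤ) :
    (∀ (Y : (Over U)ᵒᵖ) (s : (M.over U).val.obj Y), m • s = 0 → s = 0) ↔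
      ∀ (V : X.Opens), V ≤ U → ∀ s : Γ(M, V), m • s = 0 → s = 0 :=
  ⟨fun h _ hV s hs ↦ h (op (Over.mk (homOfLE hV))) s hs,
    fun h Y s hs ↦ h Y.unop.left (leOfHom Y.unop.hom) s hs⟩

/-- **Restriction and torsion**: for an open `U ⊆ X`, `m • 𝟙 (M.over U)` is a monomorphism (of
sheaves of modules on the opens over `U`) iff no section of `M` over an open `V ≤ U` is killed by
`m`. [folklore] -/
theorem schemeModules_mono_zsmul_id_over_iff (M : X.Modules) (U : X.Opens) (m : ℤ) :
    Mono (m • 𝟙 (M.over U)) ↔ ∀ (V : X.Opens), V ≤ U → ∀ s : Γ(M, V), m • s = 0 → s = 0 :=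
  (SheafOfModules.mono_zsmul_id_iff_torsionFree (R := X.ringCatSheaf.over U) (M.over U) m).trans
    (over_torsionFree_iff M U m)

/-- Restriction to an open preserves `m`-torsion-freeness: if `m • 𝟙 M` is a monomorphism, so
is `m • 𝟙 (M.over U)`. [folklore] -/
theorem schemeModules_mono_zsmul_id_over (M : X.Modules) (m : ℤ) [Mono (m • 𝟙 M)]
    (U : X.Opens) : Mono (m • 𝟙 (M.over U)) :=
  (schemeModules_mono_zsmul_id_over_iff M U m).mpr fun V _ s hs ↦
    (schemeModules_mono_zsmul_id_iff_torsionFree M m).mp ‹_› V s hs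

/-! ### Mono is local on the base -/

/-- A section of an `𝒪_X`-module which vanishes on a neighbourhood of every point of its domain
is zero (the separatedness half of the sheaf condition). [folklore] -/
theorem schemeModules_section_eq_zero_of_locally {M : X.Modules} {V : X.Opens} (s : Γ(M, V))
    (h : ∀ x ∈ V, ∃ (W : X.Opens) (hW : W ≤ V), x ∈ W ∧ M.presheaf.map (homOfLE hW).op s = 0) :
    s = 0 := by
  choose W hWV hxW hW using h
  refine TopCat.Sheaf.eq_of_locally_eq' (C := AddCommGrpCat.{u}) ⟨M.presheaf, M.isSheaf⟩
    (fun x : V ↦ W x.1 x.2) V (fun x ↦ homOfLE (hWV x.1 x.2)) (fun x hx ↦ ?_) s 0 fun x ↦ ?_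
  · exact TopologicalSpace.Opens.mem_iSup.mpr ⟨⟨x, hx⟩, hxW x hx⟩
  · rw [map_zero]
    exact hW x.1 x.2

/-- **Locality of torsion-freeness, sectionwise form**: if every point of `X` has an open
neighbourhood `U` such that no section of `M` over an open `V ≤ U` is killed by `m`, then
`m • 𝟙 M` is a monomorphism. Proof: a section `s ∈ Γ(M, V)` with `m • s = 0` restricts to
sections of the `V ⊓ U_x` killed by `m`, which vanish, so `s = 0` by the sheaf condition.
[folklore] -/
theorem schemeModules_mono_zsmul_id_of_locally_torsionFree (M : X.Modules) (m : ℤ)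
    (h : ∀ x : X, ∃ U : X.Opens, x ∈ U ∧
      ∀ (V : X.Opens), V ≤ U → ∀ s : Γ(M, V), m • s = 0 → s = 0) :
    Mono (m • 𝟙 M) := by
  rw [schemeModules_mono_zsmul_id_iff_torsionFree]
  intro V s hs
  refine schemeModules_section_eq_zero_of_locally s fun x hx ↦ ?_
  obtain ⟨U, hxU, hU⟩ := h x
  refine ⟨V ⊓ U, inf_le_left, ⟨hx, hxU⟩, hU (V ⊓ U) inf_le_right _ ?_⟩
  rw [← map_zsmul, hs, map_zero]

/-- **Mono is local on the base**: if every point of `X` has an open neighbourhood `U` with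
`Mono (m • 𝟙 (M.over U))`, then `Mono (m • 𝟙 M)`. [folklore] -/
theorem schemeModules_mono_zsmul_id_of_cover (M : X.Modules) (m : ℤ)
    (h : ∀ x : X, ∃ U : X.Opens, x ∈ U ∧ Mono (m • 𝟙 (M.over U))) : Mono (m • 𝟙 M) :=
  schemeModules_mono_zsmul_id_of_locally_torsionFree M m fun x ↦ by
    obtain ⟨U, hxU, hU⟩ := h x
    exact ⟨U, hxU, (schemeModules_mono_zsmul_id_over_iff M U m).mp hU⟩

/-- **Mono is local on the base**, indexed-cover form: if `X = ⋃ᵢ Uᵢ` with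
`Mono (m • 𝟙 (M.over Uᵢ))` for all `i`, then `Mono (m • 𝟙 M)`. [folklore] -/
theorem schemeModules_mono_zsmul_id_of_iSup_eq_top (M : X.Modules) (m : ℤ) {ι : Type*}
    (U : ι → X.Opens) (hU : iSup U = ⊤) (h : ∀ i, Mono (m • 𝟙 (M.over (U i)))) :
    Mono (m • 𝟙 M) :=
  schemeModules_mono_zsmul_id_of_cover M m fun x ↦ by
    have hx : x ∈ iSup U := by rw [hU]; trivial
    obtain ⟨i, hi⟩ := TopologicalSpace.Opens.mem_iSup.mp hx
    exact ⟨U i, hi, h i⟩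

/-- `m • 𝟙 M` is a monomorphism iff every point has an open neighbourhood `U` with
`Mono (m • 𝟙 (M.over U))`. [folklore] -/
theorem schemeModules_mono_zsmul_id_iff_locally (M : X.Modules) (m : ℤ) :
    Mono (m • 𝟙 M) ↔ ∀ x : X, ∃ U : X.Opens, x ∈ U ∧ Mono (m • 𝟙 (M.over U)) :=
  ⟨fun _ _ ↦ ⟨⊤, trivial, schemeModules_mono_zsmul_id_over M m ⊤⟩,
    schemeModules_mono_zsmul_id_of_cover M m⟩

/-! ### Locally free modules of finite rank -/

/-- The rings of sections of the over-site of `U` are the `Γ(X, V)`, `V ≤ U`: if no `Γ(X, V)`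
has `m`-torsion, neither has any ring of sections of `𝒪_X.over U`. [folklore] -/
theorem ringCatSheaf_over_torsionFree (U : X.Opens) (m : ℤ)
    (h : ∀ (V : X.Opens) (r : Γ(X, V)), m • r = 0 → r = 0) (Y : (Over U)ᵒᵖ)
    (r : (X.ringCatSheaf.over U).obj.obj Y) (hr : m • r = 0) : r = 0 :=
  h Y.unop.left r hr

/-- A module which is free of finite rank over an open `U`, `𝒪^I ≅ M.over U`, has no `m`-torsion
over `U` as soon as no ring of sections `Γ(X, V)` has. [folklore] -/
theorem schemeModules_mono_zsmul_id_over_of_iso_free (M : X.Modules) (U : X.Opens) {I : Type u}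
    [Finite I] (e : SheafOfModules.free (R := X.ringCatSheaf.over U) I ≅ M.over U) (m : ℤ)
    (h : ∀ (V : X.Opens) (r : Γ(X, V)), m • r = 0 → r = 0) : Mono (m • 𝟙 (M.over U)) :=
  (mono_zsmul_id_iff_of_iso m e).mp
    (SheafOfModules.mono_zsmul_id_free (R := X.ringCatSheaf.over U) m I
      (ringCatSheaf_over_torsionFree U m h))

/-- **A finite locally free `𝒪_X`-module over torsion-free rings of sections is torsion-free**:
if `M` is finite locally free (`M|_U ≅ 𝒪_U^I`, `I` finite, near every point) and no ring of
sections `Γ(X, U)` has `m`-torsion, then `m • 𝟙 M` is a monomorphism, i.e. (by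
`schemeModules_mono_zsmul_id_iff_torsionFree`) no section of `M` is killed by `m`. Locality
(`schemeModules_mono_zsmul_id_of_cover`) and the free case on each trivialising open.
[folklore] -/
theorem mono_zsmul_id_of_isFiniteLocallyFree {M : X.Modules} (hM : IsFiniteLocallyFree M)
    (m : ℤ) (h : ∀ (U : X.Opens) (r : Γ(X, U)), m • r = 0 → r = 0) : Mono (m • 𝟙 M) :=
  schemeModules_mono_zsmul_id_of_cover M m fun x ↦ by
    obtain ⟨U, hxU, I, hI, ⟨e⟩⟩ := hM x
    exact ⟨U, hxU, schemeModules_mono_zsmul_id_over_of_iso_free M U e m h⟩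

/-- Locally free local generators data with finite index sets (Mathlib's
`SheafOfModules.LocalGeneratorsData` with `IsLocallyFreeData`: the maps `𝒪^{I_i} → M.over (U i)`
are isomorphisms over a cover `U` of `X`) make `M` finite locally free. [folklore] -/
theorem isFiniteLocallyFree_of_isLocallyFreeData {M : X.Modules}
    (q : SheafOfModules.LocalGeneratorsData.{u} (R := X.ringCatSheaf) M) (hq : q.IsLocallyFreeData)
    (hfin : ∀ i, Finite (q.generators i).I) : IsFiniteLocallyFree M := fun x ↦ by
  obtain ⟨i, hi⟩ := ((Opens.coversTop_iff _ q.X).mp q.coversTop).exists_mem x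
  exact ⟨q.X i, hi, (q.generators i).I, hfin i, ⟨asIso (q.generators i).π⟩⟩

/-- **Locally free of finite rank ⇒ torsion-free over torsion-free rings of sections**, in the
form of locally free local generators data with finite index sets (the shape of
`Motives.HasRank`, `Motives.HasRankLE`, `Motives.hasRank_hodgeSheaf_choose`). [folklore] -/
theorem mono_zsmul_id_of_isLocallyFreeData {M : X.Modules}
    (q : SheafOfModules.LocalGeneratorsData.{u} (R := X.ringCatSheaf) M) (hq : q.IsLocallyFreeData)
    (hfin : ∀ i, Finite (q.generators i).I) (m : ℤ)
    (h : ∀ (U : X.Opens) (r : Γ(X, U)), m • r = 0 → r = 0) : Mono (m • 𝟙 M) :=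
  mono_zsmul_id_of_isFiniteLocallyFree (isFiniteLocallyFree_of_isLocallyFreeData q hq hfin) m h

/-- A module of rank `≤ r` (`Motives.HasRankLE`) over torsion-free rings of sections has no
`m`-torsion. [folklore] -/
theorem mono_zsmul_id_of_hasRankLE {M : X.Modules} {r : ℕ} (hM : HasRankLE M r) (m : ℤ)
    (h : ∀ (U : X.Opens) (r : Γ(X, U)), m • r = 0 → r = 0) : Mono (m • 𝟙 M) :=
  mono_zsmul_id_of_isFiniteLocallyFree hM.isFiniteLocallyFree m h

end Literature.AlgebraicGeometry.Modules
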